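/-
Origin: expansion seat `planner-pub-hodgecm-mc-glue-1-g11-0`, handover #SG39 2026-08-20T16:55:47Z md5 fd50116bb9c5 (REPLACE; pre md5 2c3f8f0fcc86 → new md5 fd50116bb9c5; 167 l.; (μ4) scope-guard rewrite of the RUN-55 installed file; family glue-1; compiled ok 0 proof-hole) (`HOME/mc/pub-hodgecm-mc-glue-1-g11/stage56/HodgeCM/Model/E2InstanceOGR21AEPISTRDMW.lean`, md5 fd50116bb9c5, 167 lines);
landed by the second packager p2 gen 10 (p2-g10) in gate run 56 REPLACES the earlier landed copy of `HodgeCM/Model/E2InstanceOGR21AEPISTRDMW.lean` (seat copy carried the packager Origin header of an earlier run (stripped)).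
-/
/-
Origin: CONSTRUCTION seat `planner-pub-hodgecm-mc-glue-1-g10-0` (unit pub-hodgecm-mc-glue-1-g10, gen 10 of mc-glue-1, node E ASSEMBLER),
generated from glue-1's #397M `HodgeCM/Model/E2InstanceOGR21AEPISTRDM.lean` (e6fa82fb6979) and the E-level residual family texts `jD homg homg₃₄` of
glue-1's installed #398 `HodgeCM/Model/E2InstanceOGR21AEPISCW.lean` (from binder-2 #56) by `tools/gen_ogistrdmw.py`; KERNEL only: 1 theorem, 0 defs;
intended closure {propext, Classical.choice, Quot.sound}.  The ROW-4/18/19 W PIN CHILD AT THE R1 PIN: `W` pinned at binder-2's census family at the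
constructed pin's character, rows 18/19 at binder-2 RUN-46 #78 `HypCensus.hyp12_of_census_R1At`/`hyp34_of_census_R1At` modulo `jD homg homg₃₄` ONLY;
a closing-chain leaf beside E — record status is the lead's ruling, not this file's claim.
-/
import Summits.HodgeConjecture.HodgeCM.Model.E2InstanceOGR21AEPISTRDM
import Summits.HodgeConjecture.HodgeCM.Model.HypCensus.KappaJoin


noncomputable section

open scoped TensorProduct InnerProductSpace Matrix

open Literature.NumberTheory.Automorphic Literature.NumberTheory.Weil1964
open Literature.NumberTheory.GelbartRogawski1991.UnitaryDualPair
open HodgeCM.Adelic HodgeCM.PerL34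
open scoped Classical
open Literature.Geometry.ComplexHyperbolic.BallModel (U21 x₀ stabilizerEquivK21)
open Literature.NumberTheory.Automorphic.U21 (K21 matA sclD)




/-!
# E2InstanceOGR21AEPISTRDMW — the row-4/18/19 W pin child of `perL_picardCM_r21AEOGISTRDM` at the R1 pin

`perL_picardCM_r21AEOGISTRDMW` = `perL_picardCM_r21AEOGISTRDM` (#397M: the full (R1) child at `μ♯ := ArchSideTerm.muSharp μ`, 16 groups
`hA W hGR hGR₀ hGR₁ hGR₂ hGR₃ μ hΔ₂ hΔ₃ hR hΘ gen12 real34 hyp12 hyp34`) with row 4 `W` PINNED at binder-2's census family AT THE CONSTRUCTED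
PIN'S (J-η) CHARACTER — `W := HypCensus.Wcm hGR η″ hη″ hηc″`, `η″ := EtaChi.η (SInstance.χVR hGR hGR₀ hGR₁) (SInstance.χWR hGR hGR₀ hGR₁ μ♯)`
(`hη″ hηc″ := EtaChi.hη / EtaChi.hηc`; under the guard this IS the character of the pin `SInstance.SROGTC hGR hGR₀..₃ μ♯ …` by sinst-1's
`SInstance.SROGTC_eq_archSideOfT`, as binder-1 #37 requires for rows 16/17) — and rows 18 `hyp12` / 19 `hyp34` DISCHARGED by binder-2's RUN-46
#78 `HypCensus.hyp12_of_census_R1At` / `HypCensus.hyp34_of_census_R1At` (`HypCensus/KappaJoin` §3, over #77 `HypOfCensusType`, #76 `KappaType`,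
#75 and carch-1's #CA37/#CA38 `hκ_R1`/`ArchKTypeOfSigmaIotaVal`): at the constructed `χV := SInstance.χVR` the (V-val) K∞-letter identity `hκ`
is a THEOREM (`hasArchType_χVR_pairType`) and (J-dense) is binder-2 #70, so E's rows 18/19 at one good canonical context follow from the context
datum `jD` and the (J-T12)/(J-T34) printed-torus equivariance junctions `homg`/`homg₃₄` ALONE — applied pointwise
`hyp12 := fun V c hc h6 hcan => HypCensus.hyp12_of_census_R1At hHD hI h₁ h₃′ hA hGR hGR₀ hGR₁ (SInstance.χWR hGR hGR₀ hGR₁ μ♯)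
(SInstance.SROGTC … μ♯ …) μ♯ V c hc h6 hcan (fun _ _ => 0) (homg V c)` (row 19 likewise with `homg₃₄`), `h₃′ := cmAbelianVarietyRealised_of_eigenbasis
hHD hI h₃`, with the context datum INSTANTIATED `jD := fun _ _ => (0 : Fin 6)` (the constant equivariance-slot choice; binder-2-g14 DATA NOTE
2026-08-20: the census theorems take `jD` with NO hypothesis, any function works — it is not a residual).  The two residual families `homg homg₃₄`
are glue-1 #398's E-level family texts (installed `E2InstanceOGR21AEPISCW`, from binder-2 #56, namespace-qualified) re-pinned
`χV ↦ SInstance.χVR hGR hGR₀ hGR₁`, `μ ↦ μ♯`, `jD V c ↦ fun _ _ => 0` (so row 18's printed vacua read `-μ♯ c 0`, `-μ♯ c 1` and row 19's `-μ♯ c 2`,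
`-μ♯ c 3`, exactly the exponents of #397M's model `d12Of μ♯`/`d34Of μ♯`); `jD`, (V-val) `hκ` and (J-dense) `hdense₁₂`/`hdense₃₄` of #398 do NOT
enter.  Rows 16 `gen12` / 17 `real34` STAY (their producers of record, binder-1 #37/#42, are typed at the ν-free pin `SROG`, not at
the ν-carrying constructed pin); their texts and `hΘ`'s are #397M's with `W ↦` the pin, byte-for-byte otherwise.
Binder groups: `hA hGR hGR₀ hGR₁ hGR₂ hGR₃ μ hΔ₂ hΔ₃ hR hΘ gen12 real34 homg homg₃₄` (15 = 16 − 3 + 2: `W hyp12 hyp34` out, `homg homg₃₄` in);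
ROWS 18/19 RESIDUAL displayed AS TYPED, NOT discharged: `homg`/`homg₃₄` are the (J-T12)/(J-T34) `∀ φ` junctions shared by rows 17–19, and by
binder-2's DIVERGENCE b2g11-1 + addendum (2026-08-20) that junction is FALSE AS TYPED at any good context with a Σ₁₂ place of ε_b = −1 (desk
ruling (B1)/(B2)/(φ₀ re-cut) pending; under (B1) — an orientation-aware `PlaceKind` REPLACED inside E's cone — these binder TEXTS stay byte-identical
and the junction becomes a theorem modulo (J-μ) `hμ`); until then this leaf is a TYPED SOCKET for rows 4/18/19 at the R1 pin, exactly as #398/#399T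
are at the `SROG` pin, and claims no discharge of rows 18/19; conclusion `Universe.PerL` unchanged; proof = ONE application.  ADDITIVE LEAF of the closing chain
beside E; no new definition, record or cite enters; nothing of PerL ∕ QW8 is claimed.
-/

namespace HodgeCM

namespace Model

open HodgeCM.Model.ArchSideTerm
open HodgeCM.Universe (AdelicThetaCore AdelicThetaCore₀ SideData ThetaModel ModelAxiomsPerL)
open Literature.AlgebraicGeometry.HodgeTheory
open Literature.AlgebraicGeometry.ComplexMultiplication (Shimura1998_Thm3_isogenousPower Shimura1998_Thm2_Cor)
open Literature.NumberTheory.Automorphic.PicardCM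
open Literature.NumberTheory.Transcendental (Arapura2012_Cor_15_4_6)
open HodgeCM.CMTypeOps (inflate)
open HodgeCM.Model.SupplyResidual (ClassSupplyPackN)
open HodgeCM.Model.ThetaSpace

variable (hHD : exists_isReal_hodgeModel) (hI : hodgePQ_independent_of_hodgeModel)
  (h₁ : BallQuotientUniformised)  (h₃ : CMAbelianVarietyEigenbasisRealised)

/-- **ROW-4/18/19 W PIN CHILD AT THE R1 PIN** (`W := HypCensus.Wcm hGR η″ hη″ hηc″` at the constructed pin's character; rows 18/19 at
binder-2 #78 `hyp12_of_census_R1At`/`hyp34_of_census_R1At` modulo `homg homg₃₄` only, `jD := fun _ _ => 0`; 15 binder groups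
`hA hGR hGR₀ hGR₁ hGR₂ hGR₃ μ hΔ₂ hΔ₃ hR hΘ gen12 real34 homg homg₃₄`; rows 18/19 junction displayed AS TYPED — FALSE as typed at ε_b = −1 Σ₁₂ places per
binder-2 DIVERGENCE b2g11-1, desk ruling pending). -/
theorem perL_picardCM_r21AEOGISTRDMW (hA : Arapura2012_Cor_15_4_6)
    (hGR : ∀ {L : CMField} {ι₁ : L →+* ℂ} (V : HermSpace3 L ι₁) (c : SeesawCtx L),
      (cmSplittingDatum (L : Type) finProdFinEquiv (frameD V) (frameD_real V) (frameD_ne V) (dW c.D) (dW_real c.D)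
        (dW_ne c.D)).CompatibleSplitting)
    (hGR₀ : ∀ {L : CMField} {ι₁ : L →+* ℂ} (V : HermSpace3 L ι₁) (c : SeesawCtx L),
      (cmSplittingDatum (L : Type) (e₁) (frameD V) (frameD_real V) (frameD_ne V) (lineVec (L : Type) (dW c.D 0))
        (fun _ => dW_real c.D 0) (fun _ => dW_ne c.D 0)).CompatibleSplitting)
    (hGR₁ : ∀ {L : CMField} {ι₁ : L →+* ℂ} (V : HermSpace3 L ι₁) (c : SeesawCtx L),
      (cmSplittingDatum (L : Type) (e₁) (frameD V) (frameD_real V) (frameD_ne V) (lineVec (L : Type) (dW c.D 1))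
        (fun _ => dW_real c.D 1) (fun _ => dW_ne c.D 1)).CompatibleSplitting)
    (hGR₂ : ∀ {L : CMField} {ι₁ : L →+* ℂ} (V : HermSpace3 L ι₁) (c : SeesawCtx L),
      (cmSplittingDatum (L : Type) (e₁) (frameD V) (frameD_real V) (frameD_ne V) (lineVec (L : Type) (dW' c.D 0))
        (fun _ => dW'_real c.D 0) (fun _ => dW'_ne c.D 0)).CompatibleSplitting)
    (hGR₃ : ∀ {L : CMField} {ι₁ : L →+* ℂ} (V : HermSpace3 L ι₁) (c : SeesawCtx L),
      (cmSplittingDatum (L : Type) (e₁) (frameD V) (frameD_real V) (frameD_ne V) (lineVec (L : Type) (dW' c.D 1))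
        (fun _ => dW'_real c.D 1) (fun _ => dW'_ne c.D 1)).CompatibleSplitting)
    (μ : ∀ {L : CMField}, SeesawCtx L → Fin 4 → NumberField.InfinitePlace L → ℤ)
    (hΔ₂ : ∀ {L : CMField} {ι₁ : L →+* ℂ} (V : HermSpace3 L ι₁) (c : SeesawCtx L), ∀ hc : SInstance.GOG V c,
      slotTypeVec V c (hGR V c) (hGR₀ V c) (hGR₁ V c) (hGR₂ V c) (hGR₃ V c) (SInstance.hG_GOG V c hc) 2 -
        slotTypeVec V c (hGR V c) (hGR₀ V c) (hGR₁ V c) (hGR₂ V c) (hGR₃ V c) (SInstance.hG_GOG V c hc) 0 = μ c 2 - μ c 0)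
    (hΔ₃ : ∀ {L : CMField} {ι₁ : L →+* ℂ} (V : HermSpace3 L ι₁) (c : SeesawCtx L), ∀ hc : SInstance.GOG V c,
      slotTypeVec V c (hGR V c) (hGR₀ V c) (hGR₁ V c) (hGR₂ V c) (hGR₃ V c) (SInstance.hG_GOG V c hc) 3 -
        slotTypeVec V c (hGR V c) (hGR₀ V c) (hGR₁ V c) (hGR₂ V c) (hGR₃ V c) (SInstance.hG_GOG V c hc) 0 = μ c 3 - μ c 0)
    (hR : DeligneMilne1982_Thm_6_20_full)
    (hΘ : ∀ {L : CMField} {ι₁ : L →+* ℂ} (V : HermSpace3 L ι₁) (c : SeesawCtx L),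
      (thetaModelOf hHD hI h₁ (cmAbelianVarietyRealised_of_eigenbasis hHD hI h₃) (orientBitι L ι₁) (embOf hHD hI h₁ (cmAbelianVarietyRealised_of_eigenbasis hHD hI h₃)) (coverOf hHD hI h₁ (cmAbelianVarietyRealised_of_eigenbasis hHD hI h₃) hA) (wmOfInput (HypCensus.Wcm hGR (EtaChi.η (@SInstance.χVR @hGR @hGR₀ @hGR₁) (@SInstance.χWR @hGR @hGR₀ @hGR₁ (ArchSideTerm.muSharp @μ))) (EtaChi.hη (@SInstance.χVR @hGR @hGR₀ @hGR₁) (@SInstance.χWR @hGR @hGR₀ @hGR₁ (ArchSideTerm.muSharp @μ))) (EtaChi.hηc (@SInstance.χVR @hGR @hGR₀ @hGR₁) (@SInstance.χWR @hGR @hGR₀ @hGR₁ (ArchSideTerm.muSharp @μ))))) (thetaOf _ (thetaClassInputOf _ (fun V c => thetaSpaceInputOf hHD hI h₁ (cmAbelianVarietyRealised_of_eigenbasis hHD hI h₃) (SInstance.SROGTC @hGR @hGR₀ @hGR₁ @hGR₂ @hGR₃ (ArchSideTerm.muSharp @μ) (ArchSideTerm.hΔ₁_GOG_muSharp @hGR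 @hGR₀ @hGR₁ @hGR₂ @hGR₃ @μ) (ArchSideTerm.hΔ₂_GOG_muSharp @hGR @hGR₀ @hGR₁ @hGR₂ @hGR₃ @μ hΔ₂) (ArchSideTerm.hΔ₃_GOG_muSharp @hGR @hGR₀ @hGR₁ @hGR₂ @hGR₃ @μ hΔ₃)) V c))) (d12Of (ArchSideTerm.muSharp @μ)) (d34Of (ArchSideTerm.muSharp @μ))).GoodCtx ι₁ c → Module.finrank ℚ c.K = 6 ∧ IsNormalClosure ℚ c.K L ∧ (Module.finrank ℚ L = 24 ∨ Module.finrank ℚ L = 48) →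
      (NumberField.InfinitePlace.mk ι₁).embedding = ι₁ →
      ∀ i : Fin 4, ∃ Γ₀ : Level V, ∀ Γ ≤ Γ₀,
        ∃ D : CommonReflexInput c.K (c.Ψ i) c.σ,
          (thetaModelOf hHD hI h₁ (cmAbelianVarietyRealised_of_eigenbasis hHD hI h₃) (orientBitι L ι₁) (embOf hHD hI h₁ (cmAbelianVarietyRealised_of_eigenbasis hHD hI h₃)) (coverOf hHD hI h₁ (cmAbelianVarietyRealised_of_eigenbasis hHD hI h₃) hA) (wmOfInput (HypCensus.Wcm hGR (EtaChi.η (@SInstance.χVR @hGR @hGR₀ @hGR₁) (@SInstance.χWR @hGR @hGR₀ @hGR₁ (ArchSideTerm.muSharp @μ))) (EtaChi.hη (@SInstance.χVR @hGR @hGR₀ @hGR₁) (@SInstance.χWR @hGR @hGR₀ @hGR₁ (ArchSideTerm.muSharp @μ))) (EtaChi.hηc (@SInstance.χVR @hGR @hGR₀ @hGR₁) (@SInstance.χWR @hGR @hGR₀ @hGR₁ (ArchSideTerm.muSharp @μ))))) (thetaOf _ (thetaClassInputOf _ (fun V c => thetaSpaceInputOf hHD hI h₁ (cmAbelianVarietyRealised_of_eigenbasis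 hHD hI h₃) (SInstance.SROGTC @hGR @hGR₀ @hGR₁ @hGR₂ @hGR₃ (ArchSideTerm.muSharp @μ) (ArchSideTerm.hΔ₁_GOG_muSharp @hGR @hGR₀ @hGR₁ @hGR₂ @hGR₃ @μ) (ArchSideTerm.hΔ₂_GOG_muSharp @hGR @hGR₀ @hGR₁ @hGR₂ @hGR₃ @μ hΔ₂) (ArchSideTerm.hΔ₃_GOG_muSharp @hGR @hGR₀ @hGR₁ @hGR₂ @hGR₃ @μ hΔ₃)) V c))) (d12Of (ArchSideTerm.muSharp @μ)) (d34Of (ArchSideTerm.muSharp @μ))).Theta V c i Γ ⊆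
            Submodule.span ℂ (D.surfaceClasses hHD hI h₁ (cmAbelianVarietyRealised_of_eigenbasis hHD hI h₃) V Γ))
    (gen12 : ∀ {L : CMField} {ι₁ : L →+* ℂ} (V : HermSpace3 L ι₁) (c : SeesawCtx L),
      (thetaModelOf hHD hI h₁ (cmAbelianVarietyRealised_of_eigenbasis hHD hI h₃) (orientBitι L ι₁) (embOf hHD hI h₁ (cmAbelianVarietyRealised_of_eigenbasis hHD hI h₃)) (coverOf hHD hI h₁ (cmAbelianVarietyRealised_of_eigenbasis hHD hI h₃) hA) (wmOfInput (HypCensus.Wcm hGR (EtaChi.η (@SInstance.χVR @hGR @hGR₀ @hGR₁) (@SInstance.χWR @hGR @hGR₀ @hGR₁ (ArchSideTerm.muSharp @μ))) (EtaChi.hη (@SInstance.χVR @hGR @hGR₀ @hGR₁) (@SInstance.χWR @hGR @hGR₀ @hGR₁ (ArchSideTerm.muSharp @μ))) (EtaChi.hηc (@SInstance.χVR @hGR @hGR₀ @hGR₁) (@SInstance.χWR @hGR @hGR₀ @hGR₁ (ArchSideTerm.muSharp @μ))))) (thetaOf _ (thetaClassInputOf _ (fun V c => thetaSpaceInputOf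 hHD hI h₁ (cmAbelianVarietyRealised_of_eigenbasis hHD hI h₃) (SInstance.SROGTC @hGR @hGR₀ @hGR₁ @hGR₂ @hGR₃ (ArchSideTerm.muSharp @μ) (ArchSideTerm.hΔ₁_GOG_muSharp @hGR @hGR₀ @hGR₁ @hGR₂ @hGR₃ @μ) (ArchSideTerm.hΔ₂_GOG_muSharp @hGR @hGR₀ @hGR₁ @hGR₂ @hGR₃ @μ hΔ₂) (ArchSideTerm.hΔ₃_GOG_muSharp @hGR @hGR₀ @hGR₁ @hGR₂ @hGR₃ @μ hΔ₃)) V c))) (d12Of (ArchSideTerm.muSharp @μ)) (d34Of (ArchSideTerm.muSharp @μ))).GoodCtx ι₁ c → Module.finrank ℚ c.K = 6 ∧ IsNormalClosure ℚ c.K L ∧ (Module.finrank ℚ L = 24 ∨ Module.finrank ℚ L = 48) →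
      (NumberField.InfinitePlace.mk ι₁).embedding = ι₁ →
      Nonempty ((thetaModelOf hHD hI h₁ (cmAbelianVarietyRealised_of_eigenbasis hHD hI h₃) (orientBitι L ι₁) (embOf hHD hI h₁ (cmAbelianVarietyRealised_of_eigenbasis hHD hI h₃)) (coverOf hHD hI h₁ (cmAbelianVarietyRealised_of_eigenbasis hHD hI h₃) hA) (wmOfInput (HypCensus.Wcm hGR (EtaChi.η (@SInstance.χVR @hGR @hGR₀ @hGR₁) (@SInstance.χWR @hGR @hGR₀ @hGR₁ (ArchSideTerm.muSharp @μ))) (EtaChi.hη (@SInstance.χVR @hGR @hGR₀ @hGR₁) (@SInstance.χWR @hGR @hGR₀ @hGR₁ (ArchSideTerm.muSharp @μ))) (EtaChi.hηc (@SInstance.χVR @hGR @hGR₀ @hGR₁) (@SInstance.χWR @hGR @hGR₀ @hGR₁ (ArchSideTerm.muSharp @μ))))) (thetaOf _ (thetaClassInputOf _ (fun V c => thetaSpaceInputOf hHD hI h₁ (cmAbelianVarietyRealised_of_eigenbasis hHD hI h₃) (SInstance.SROGTC @hGR @hGR₀ @hGR₁ @hGR₂ @hGR₃ (ArchSideTerm.muSharp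 @μ) (ArchSideTerm.hΔ₁_GOG_muSharp @hGR @hGR₀ @hGR₁ @hGR₂ @hGR₃ @μ) (ArchSideTerm.hΔ₂_GOG_muSharp @hGR @hGR₀ @hGR₁ @hGR₂ @hGR₃ @μ hΔ₂) (ArchSideTerm.hΔ₃_GOG_muSharp @hGR @hGR₀ @hGR₁ @hGR₂ @hGR₃ @μ hΔ₃)) V c))) (d12Of (ArchSideTerm.muSharp @μ)) (d34Of (ArchSideTerm.muSharp @μ))).Gen12FunBridge V c))
    (real34 : ∀ {L : CMField} {ι₁ : L →+* ℂ} (V : HermSpace3 L ι₁) (c : SeesawCtx L),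
      (thetaModelOf hHD hI h₁ (cmAbelianVarietyRealised_of_eigenbasis hHD hI h₃) (orientBitι L ι₁) (embOf hHD hI h₁ (cmAbelianVarietyRealised_of_eigenbasis hHD hI h₃)) (coverOf hHD hI h₁ (cmAbelianVarietyRealised_of_eigenbasis hHD hI h₃) hA) (wmOfInput (HypCensus.Wcm hGR (EtaChi.η (@SInstance.χVR @hGR @hGR₀ @hGR₁) (@SInstance.χWR @hGR @hGR₀ @hGR₁ (ArchSideTerm.muSharp @μ))) (EtaChi.hη (@SInstance.χVR @hGR @hGR₀ @hGR₁) (@SInstance.χWR @hGR @hGR₀ @hGR₁ (ArchSideTerm.muSharp @μ))) (EtaChi.hηc (@SInstance.χVR @hGR @hGR₀ @hGR₁) (@SInstance.χWR @hGR @hGR₀ @hGR₁ (ArchSideTerm.muSharp @μ))))) (thetaOf _ (thetaClassInputOf _ (fun V c => thetaSpaceInputOf hHD hI h₁ (cmAbelianVarietyRealised_of_eigenbasis hHD hI h₃) (SInstance.SROGTC @hGR @hGR₀ @hGR₁ @hGR₂ @hGR₃ (ArchSideTerm.muSharp @μ) (ArchSideTerm.hΔ₁_GOG_muSharp @hGR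 @hGR₀ @hGR₁ @hGR₂ @hGR₃ @μ) (ArchSideTerm.hΔ₂_GOG_muSharp @hGR @hGR₀ @hGR₁ @hGR₂ @hGR₃ @μ hΔ₂) (ArchSideTerm.hΔ₃_GOG_muSharp @hGR @hGR₀ @hGR₁ @hGR₂ @hGR₃ @μ hΔ₃)) V c))) (d12Of (ArchSideTerm.muSharp @μ)) (d34Of (ArchSideTerm.muSharp @μ))).GoodCtx ι₁ c → Module.finrank ℚ c.K = 6 ∧ IsNormalClosure ℚ c.K L ∧ (Module.finrank ℚ L = 24 ∨ Module.finrank ℚ L = 48) →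
      (NumberField.InfinitePlace.mk ι₁).embedding = ι₁ →
      Nonempty ((thetaModelOf hHD hI h₁ (cmAbelianVarietyRealised_of_eigenbasis hHD hI h₃) (orientBitι L ι₁) (embOf hHD hI h₁ (cmAbelianVarietyRealised_of_eigenbasis hHD hI h₃)) (coverOf hHD hI h₁ (cmAbelianVarietyRealised_of_eigenbasis hHD hI h₃) hA) (wmOfInput (HypCensus.Wcm hGR (EtaChi.η (@SInstance.χVR @hGR @hGR₀ @hGR₁) (@SInstance.χWR @hGR @hGR₀ @hGR₁ (ArchSideTerm.muSharp @μ))) (EtaChi.hη (@SInstance.χVR @hGR @hGR₀ @hGR₁) (@SInstance.χWR @hGR @hGR₀ @hGR₁ (ArchSideTerm.muSharp @μ))) (EtaChi.hηc (@SInstance.χVR @hGR @hGR₀ @hGR₁) (@SInstance.χWR @hGR @hGR₀ @hGR₁ (ArchSideTerm.muSharp @μ))))) (thetaOf _ (thetaClassInputOf _ (fun V c => thetaSpaceInputOf hHD hI h₁ (cmAbelianVarietyRealised_of_eigenbasis hHD hI h₃) (SInstance.SROGTC @hGR @hGR₀ @hGR₁ @hGR₂ @hGR₃ (ArchSideTerm.muSharp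 @μ) (ArchSideTerm.hΔ₁_GOG_muSharp @hGR @hGR₀ @hGR₁ @hGR₂ @hGR₃ @μ) (ArchSideTerm.hΔ₂_GOG_muSharp @hGR @hGR₀ @hGR₁ @hGR₂ @hGR₃ @μ hΔ₂) (ArchSideTerm.hΔ₃_GOG_muSharp @hGR @hGR₀ @hGR₁ @hGR₂ @hGR₃ @μ hΔ₃)) V c))) (d12Of (ArchSideTerm.muSharp @μ)) (d34Of (ArchSideTerm.muSharp @μ))).Real34FunBridge V c))
    (homg : ∀ {L : CMField} {ι₁ : L →+* ℂ} (V : HermSpace3 L ι₁) (c : SeesawCtx L)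
      (hW : (∀ j, 0 < (ι₁ ((dW c.D) j)).re) ∨ ∀ j, (ι₁ ((dW c.D) j)).re < 0) (f : FinSB ↥(NumberField.maximalRealSubfield L) (Fin 6))
      (t : (HypCensus.printedAt V c.D hW (fun _ _ => (0 : Fin 6)) (fun w => -(ArchSideTerm.muSharp @μ) c 0 w) (fun w => -(ArchSideTerm.muSharp @μ) c 1 w)).Tg)
      (φ : (HypCensus.printedAt V c.D hW (fun _ _ => (0 : Fin 6)) (fun w => -(ArchSideTerm.muSharp @μ) c 0 w) (fun w => -(ArchSideTerm.muSharp @μ) c 1 w)).F),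
      HypCensus.omgW (HypCensus.Wcm hGR (EtaChi.η (@SInstance.χVR @hGR @hGR₀ @hGR₁) (@SInstance.χWR @hGR @hGR₀ @hGR₁ (ArchSideTerm.muSharp @μ))) (EtaChi.hη (@SInstance.χVR @hGR @hGR₀ @hGR₁) (@SInstance.χWR @hGR @hGR₀ @hGR₁ (ArchSideTerm.muSharp @μ))) (EtaChi.hηc (@SInstance.χVR @hGR @hGR₀ @hGR₁) (@SInstance.χWR @hGR @hGR₀ @hGR₁ (ArchSideTerm.muSharp @μ))) V c)
          (_root_.NumberField.SeesawArchTorus.printedTorusHom (HypCensus.kindOf (L : Type) (frameD V) (frameD_real V) (dW c.D) (dW_real c.D) ι₁ (HypCensus.datumAt V c.D (fun _ _ => (0 : Fin 6)) (HypCensus.jIOf V c.D hW)))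
            (HypCensus.lamOf (L : Type) (frameD V) (frameD_real V) (dW c.D) (dW_real c.D) ι₁ (HypCensus.datumAt V c.D (fun _ _ => (0 : Fin 6)) (HypCensus.jIOf V c.D hW)))
            (HypCensus.lamOf_ne_zero (L : Type) (frameD V) (frameD_real V) (dW c.D) (dW_real c.D) ι₁ (HypCensus.datumAt V c.D (fun _ _ => (0 : Fin 6)) (HypCensus.jIOf V c.D hW)))
            (c.D.jT₁₂.toMonoidHom.comp (_root_.NumberField.SeesawArchTorus.toAdeles (L : Type)))
            (Fock.PrintDict.pinnedVacs (HypCensus.kindOf (L : Type) (frameD V) (frameD_real V) (dW c.D) (dW_real c.D) ι₁ (HypCensus.datumAt V c.D (fun _ _ => (0 : Fin 6)) (HypCensus.jIOf V c.D hW)))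
              (fun w => -(ArchSideTerm.muSharp @μ) c 0 w) (fun w => -(ArchSideTerm.muSharp @μ) c 1 w)) t)
          (HypCensus.ins (L : Type) (frameD V) (frameD_real V) (frameD_ne V) (dW c.D) (dW_real c.D) (dW_ne c.D) ι₁ (HypCensus.datumAt V c.D (fun _ _ => (0 : Fin 6)) (HypCensus.jIOf V c.D hW))
            (fun w => -(ArchSideTerm.muSharp @μ) c 0 w) (fun w => -(ArchSideTerm.muSharp @μ) c 1 w) f φ) =
        HypCensus.ins (L : Type) (frameD V) (frameD_real V) (frameD_ne V) (dW c.D) (dW_real c.D) (dW_ne c.D) ι₁ (HypCensus.datumAt V c.D (fun _ _ => (0 : Fin 6)) (HypCensus.jIOf V c.D hW))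
          (fun w => -(ArchSideTerm.muSharp @μ) c 0 w) (fun w => -(ArchSideTerm.muSharp @μ) c 1 w) f ((HypCensus.printedAt V c.D hW (fun _ _ => (0 : Fin 6)) (fun w => -(ArchSideTerm.muSharp @μ) c 0 w) (fun w => -(ArchSideTerm.muSharp @μ) c 1 w)).ωT t φ))
    (homg₃₄ : ∀ {L : CMField} {ι₁ : L →+* ℂ} (V : HermSpace3 L ι₁) (c : SeesawCtx L)
      (hW : (∀ j, 0 < (ι₁ ((dW c.D) j)).re) ∨ ∀ j, (ι₁ ((dW c.D) j)).re < 0) (f : FinSB ↥(NumberField.maximalRealSubfield L) (Fin 6))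
      (t : (HypCensus.printedAt V c.D hW (fun _ _ => (0 : Fin 6)) (fun w => -(ArchSideTerm.muSharp @μ) c 2 w) (fun w => -(ArchSideTerm.muSharp @μ) c 3 w)).Tg)
      (φ : (HypCensus.printedAt V c.D hW (fun _ _ => (0 : Fin 6)) (fun w => -(ArchSideTerm.muSharp @μ) c 2 w) (fun w => -(ArchSideTerm.muSharp @μ) c 3 w)).F),
      HypCensus.omgW (HypCensus.Wcm hGR (EtaChi.η (@SInstance.χVR @hGR @hGR₀ @hGR₁) (@SInstance.χWR @hGR @hGR₀ @hGR₁ (ArchSideTerm.muSharp @μ))) (EtaChi.hη (@SInstance.χVR @hGR @hGR₀ @hGR₁) (@SInstance.χWR @hGR @hGR₀ @hGR₁ (ArchSideTerm.muSharp @μ))) (EtaChi.hηc (@SInstance.χVR @hGR @hGR₀ @hGR₁) (@SInstance.χWR @hGR @hGR₀ @hGR₁ (ArchSideTerm.muSharp @μ))) V c)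
          (_root_.NumberField.SeesawArchTorus.printedTorusHom (HypCensus.kindOf (L : Type) (frameD V) (frameD_real V) (dW c.D) (dW_real c.D) ι₁ (HypCensus.datumAt V c.D (fun _ _ => (0 : Fin 6)) (HypCensus.jIOf V c.D hW)))
            (HypCensus.lamOf (L : Type) (frameD V) (frameD_real V) (dW c.D) (dW_real c.D) ι₁ (HypCensus.datumAt V c.D (fun _ _ => (0 : Fin 6)) (HypCensus.jIOf V c.D hW)))
            (HypCensus.lamOf_ne_zero (L : Type) (frameD V) (frameD_real V) (dW c.D) (dW_real c.D) ι₁ (HypCensus.datumAt V c.D (fun _ _ => (0 : Fin 6)) (HypCensus.jIOf V c.D hW)))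
            (c.D.jT₃₄.toMonoidHom.comp (_root_.NumberField.SeesawArchTorus.toAdeles (L : Type)))
            (Fock.PrintDict.pinnedVacs (HypCensus.kindOf (L : Type) (frameD V) (frameD_real V) (dW c.D) (dW_real c.D) ι₁ (HypCensus.datumAt V c.D (fun _ _ => (0 : Fin 6)) (HypCensus.jIOf V c.D hW)))
              (fun w => -(ArchSideTerm.muSharp @μ) c 2 w) (fun w => -(ArchSideTerm.muSharp @μ) c 3 w)) t)
          (HypCensus.ins₃₄ V c.D (hGR V c) ((EtaChi.η (@SInstance.χVR @hGR @hGR₀ @hGR₁) (@SInstance.χWR @hGR @hGR₀ @hGR₁ (ArchSideTerm.muSharp @μ))) V c) (HypCensus.datumAt V c.D (fun _ _ => (0 : Fin 6)) (HypCensus.jIOf V c.D hW)) (fun w => -(ArchSideTerm.muSharp @μ) c 2 w) (fun w => -(ArchSideTerm.muSharp @μ) c 3 w) f φ) =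
        HypCensus.ins₃₄ V c.D (hGR V c) ((EtaChi.η (@SInstance.χVR @hGR @hGR₀ @hGR₁) (@SInstance.χWR @hGR @hGR₀ @hGR₁ (ArchSideTerm.muSharp @μ))) V c) (HypCensus.datumAt V c.D (fun _ _ => (0 : Fin 6)) (HypCensus.jIOf V c.D hW)) (fun w => -(ArchSideTerm.muSharp @μ) c 2 w) (fun w => -(ArchSideTerm.muSharp @μ) c 3 w) f
          ((HypCensus.printedAt V c.D hW (fun _ _ => (0 : Fin 6)) (fun w => -(ArchSideTerm.muSharp @μ) c 2 w) (fun w => -(ArchSideTerm.muSharp @μ) c 3 w)).ωT t φ)) :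
     (picardCMUniverse hHD hI h₁ (cmAbelianVarietyRealised_of_eigenbasis hHD hI h₃)).PerL :=
  perL_picardCM_r21AEOGISTRDM hHD hI h₁ h₃ hA
    (HypCensus.Wcm hGR (EtaChi.η (@SInstance.χVR @hGR @hGR₀ @hGR₁) (@SInstance.χWR @hGR @hGR₀ @hGR₁ (ArchSideTerm.muSharp @μ))) (EtaChi.hη (@SInstance.χVR @hGR @hGR₀ @hGR₁) (@SInstance.χWR @hGR @hGR₀ @hGR₁ (ArchSideTerm.muSharp @μ))) (EtaChi.hηc (@SInstance.χVR @hGR @hGR₀ @hGR₁) (@SInstance.χWR @hGR @hGR₀ @hGR₁ (ArchSideTerm.muSharp @μ))))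
    hGR hGR₀ hGR₁ hGR₂ hGR₃ μ hΔ₂ hΔ₃ hR hΘ gen12 real34
    (fun V c hc h6 hcan => HypCensus.hyp12_of_census_R1At hHD hI h₁ (cmAbelianVarietyRealised_of_eigenbasis hHD hI h₃) hA hGR hGR₀ hGR₁
      (@SInstance.χWR @hGR @hGR₀ @hGR₁ (ArchSideTerm.muSharp @μ))
      (SInstance.SROGTC @hGR @hGR₀ @hGR₁ @hGR₂ @hGR₃ (ArchSideTerm.muSharp @μ) (ArchSideTerm.hΔ₁_GOG_muSharp @hGR @hGR₀ @hGR₁ @hGR₂ @hGR₃ @μ) (ArchSideTerm.hΔ₂_GOG_muSharp @hGR @hGR₀ @hGR₁ @hGR₂ @hGR₃ @μ hΔ₂) (ArchSideTerm.hΔ₃_GOG_muSharp @hGR @hGR₀ @hGR₁ @hGR₂ @hGR₃ @μ hΔ₃))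
      (ArchSideTerm.muSharp @μ) V c hc h6.1 hcan
      (fun _ _ => (0 : Fin 6)) (homg V c))
    (fun V c hc h6 hcan => HypCensus.hyp34_of_census_R1At hHD hI h₁ (cmAbelianVarietyRealised_of_eigenbasis hHD hI h₃) hA hGR hGR₀ hGR₁
      (@SInstance.χWR @hGR @hGR₀ @hGR₁ (ArchSideTerm.muSharp @μ))
      (SInstance.SROGTC @hGR @hGR₀ @hGR₁ @hGR₂ @hGR₃ (ArchSideTerm.muSharp @μ) (ArchSideTerm.hΔ₁_GOG_muSharp @hGR @hGR₀ @hGR₁ @hGR₂ @hGR₃ @μ) (ArchSideTerm.hΔ₂_GOG_muSharp @hGR @hGR₀ @hGR₁ @hGR₂ @hGR₃ @μ hΔ₂) (ArchSideTerm.hΔ₃_GOG_muSharp @hGR @hGR₀ @hGR₁ @hGR₂ @hGR₃ @μ hΔ₃))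
      (ArchSideTerm.muSharp @μ) V c hc h6.1 hcan
      (fun _ _ => (0 : Fin 6)) (homg₃₄ V c))

end Model

end HodgeCM
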